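import Summits.CriticalPhenomena.CardyFormulaZ2.Theorems.CardyBoundaryCoulombGasRectilinearCardyStubKernelWindowLawPart5
import HarnessLib

/-!
# Stub `stub_densityWindowLaw` of line `excursion-kernel-covariance`, part 1: the renormalised window
# mass of an ARBITRARY row weight is a Riemann sum (crux `RectilinearCardy`, stmt-CriticalPhenomena-5660,
# route `CardyBoundaryCoulombGas`)

This is the weight-generic form of `kwl_window_sum_tendsto` (part 5 of the landed kernel window law,
whose statement hard-codes the cube-root weight `rowWeight`): for ANY family of row weights
`F : ℝ → Site 2 → ℝ` (mesh `δ`, vertex `v`) and a normaliser `N` satisfying the UNIFORM POINT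
ASYMPTOTICS `F δ v / (δ N δ) ≈ Φ(foot of v)` on a parameter range `[σ, σ']` carrying a window frame
(orientation `o`, height `h`, radius `r`; near every window point `Ω̄ = {nrmC o ≥ h}`), and a window
`σ < s < s' < σ'`, the renormalised window mass
`(Σ_{v ∈ rowTail s ∖ rowTail s'} F δ v) / N δ → ∫_{T s ⊓ T s'}^{T s ⊔ T s'} Φ(x e + h ν) dx`,
`T = tngC o ∘ ∂Ω`. The proof is that of `kwl_window_sum_tendsto`, verbatim: by `kwl_sdiff_vertex` /
`kwl_mem_sdiff_of_foot` the tangential coordinates of `W_δ = rowTail s ∖ rowTail s'` form a set of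
integers sandwiched between the open and the closed lattice chord, each weight is
`δ N δ (Φ(foot) + O(ε))` with the foot the lattice point `δ · tng`, and `kwl_riemann_sum` applies;
`δ · #W_δ ≤ |chord| + δ`. The density window law (`stub_densityWindowLaw`) instantiates
`F = closureDensity R`.

All [folklore].
-/

noncomputable section

open Set Filter Topology Metric
open Literature.Probability.RandomPlanarGeometry
open Literature.Probability.LatticeModels (Site meshPoint zdGraph Orient)

namespace Summit.CriticalPhenomena.CardyFormulaZ2.Cruxes.RectilinearCardy.ExcursionKernelCovariance

/-- **The renormalised window mass of a generic row weight converges to the side integral of the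
continuum kernel.** In a window frame on `[σ, σ']` (orientation `o`, height `h`, radius `r`), for a
window `σ < s < s' < σ'`, a row weight `F δ v` and a normaliser `N` satisfying the uniform point
asymptotics on `[σ, σ']` with a continuum kernel `Φ` whose restriction to the chord of the window is
continuous: `(Σ_{v ∈ rowTail s ∖ rowTail s'} F δ v) / N δ → ∫_{T s ⊓ T s'}^{T s ⊔ T s'} Φ(x e + h ν) dx`,
`T = tngC o ∘ ∂Ω` (weight-generic twin of `kwl_window_sum_tendsto`). [folklore] -/
theorem dwl_window_sum_tendsto (R : ConformalRectangle) {o : Orient} {h r σ σ' s s' : ℝ}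
    (h1 : R.mark 1 < σ) (hσs : σ < s) (hss' : s < s') (hs'σ' : s' < σ') (h3 : σ' < R.mark 3)
    (hr : 0 < r) (hh : ∀ t ∈ Icc σ σ', Orient.nrmC o (R.boundary t) = h)
    (hcl : ∀ t ∈ Icc σ σ', ∀ z, dist z (R.boundary t) < r →
      (z ∈ closure R.carrier ↔ h ≤ Orient.nrmC o z))
    (hop : ∀ t ∈ Icc σ σ', ∀ z, dist z (R.boundary t) < r → (z ∈ R.carrier ↔ h < Orient.nrmC o z))
    {F : ℝ → Site 2 → ℝ} {N : ℝ → ℝ} {Φ : ℂ → ℝ}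
    (hN : ∀ ε : ℝ, 0 < ε → ∀ᶠ δ in 𝓝[>] (0 : ℝ), ∀ v ∈ boundaryRow R δ, ∀ τ ∈ Icc σ σ',
      dist (meshPoint δ v) (R.boundary τ) ≤ 4 * δ → |F δ v / (δ * N δ) - Φ (R.boundary τ)| ≤ ε)
    (hΦc : ContinuousOn (fun x : ℝ => Φ (((x : ℝ) : ℂ) * Orient.e o + ((h : ℝ) : ℂ) * Orient.ν o))
      (Icc (Orient.tngC o (R.boundary s) ⊓ Orient.tngC o (R.boundary s'))
        (Orient.tngC o (R.boundary s) ⊔ Orient.tngC o (R.boundary s')))) :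
    Tendsto (fun δ => (∑ v ∈ rowTail R δ s \ rowTail R δ s', F δ v) / N δ) (𝓝[>] 0)
      (𝓝 (∫ x in (Orient.tngC o (R.boundary s) ⊓ Orient.tngC o (R.boundary s'))..
        (Orient.tngC o (R.boundary s) ⊔ Orient.tngC o (R.boundary s')),
        Φ (((x : ℝ) : ℂ) * Orient.e o + ((h : ℝ) : ℂ) * Orient.ν o))) := by
  set T : ℝ → ℝ := fun t => Orient.tngC o (R.boundary t) with hT
  set f : ℝ → ℝ := fun x => Φ (((x : ℝ) : ℂ) * Orient.e o + ((h : ℝ) : ℂ) * Orient.ν o) with hf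
  set α : ℝ := T s ⊓ T s' with hα
  set β : ℝ := T s ⊔ T s' with hβ
  change Tendsto (fun δ => (∑ v ∈ rowTail R δ s \ rowTail R δ s', F δ v) / N δ) (𝓝[>] 0)
    (𝓝 (∫ x in α..β, f x))
  have hσσ' : σ ≤ σ' := hσs.le.trans (hss'.le.trans hs'σ'.le)
  have hsI : s ∈ Icc σ σ' := ⟨hσs.le, hss'.le.trans hs'σ'.le⟩
  have hs'I : s' ∈ Icc σ σ' := ⟨hσs.le.trans hss'.le, hs'σ'.le⟩
  have hTne : T s ≠ T s' := fun heq => hss'.ne (kwl_injOn_tng R h1 h3 hh hsI hs'I heq)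
  have hαβ : α < β := by
    rcases lt_or_gt_of_ne hTne with hlt | hlt
    · rw [hα, hβ, inf_eq_left.2 hlt.le, sup_eq_right.2 hlt.le]; exact hlt
    · rw [hα, hβ, inf_eq_right.2 hlt.le, sup_eq_left.2 hlt.le]; exact hlt
  -- window values lie in the chord
  have hmono := kwl_strictMonoOn_or_strictAntiOn_tng R h1 hσσ' h3 hh
  have hchord : ∀ u ∈ Icc s s', α ≤ T u ∧ T u ≤ β := by
    intro u hu
    have huI : u ∈ Icc σ σ' := ⟨hσs.le.trans hu.1, hu.2.trans hs'σ'.le⟩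
    rcases hmono with hm | hm
    · have h1' : T s ≤ T u := hm.monotoneOn hsI huI hu.1
      have h2' : T u ≤ T s' := hm.monotoneOn huI hs'I hu.2
      exact ⟨inf_le_left.trans h1', h2'.trans le_sup_right⟩
    · have h1' : T u ≤ T s := hm.antitoneOn hsI huI hu.1
      have h2' : T s' ≤ T u := hm.antitoneOn huI hs'I hu.2
      exact ⟨inf_le_right.trans h2', h1'.trans le_sup_left⟩
  obtain ⟨d₀, hd₀, hsep⟩ := kwl_exists_param_sep R h1 hσs hss'.le hs'σ' h3
  refine Metric.tendsto_nhds.2 fun ε hε => ?_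
  -- Riemann sums with `ε/2`, point asymptotics with `ε₁`
  obtain ⟨δ₀, hδ₀, hRiem⟩ := kwl_riemann_sum hαβ.le hΦc (half_pos hε)
  have hL : 0 < β - α + 2 := by linarith
  set ε₁ : ℝ := ε / (4 * (β - α + 2)) with hε₁
  have hε₁pos : 0 < ε₁ := by positivity
  have hsmall : ∀ᶠ δ in 𝓝[>] (0 : ℝ), 0 < δ ∧ δ < min (min δ₀ 1) (min (r / 4) (d₀ / 2)) :=
    Ioo_mem_nhdsGT (by positivity)
  filter_upwards [hN ε₁ hε₁pos, hsmall] with δ hNδ hδI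
  obtain ⟨hδ, hδlt⟩ := hδI
  have hδδ₀ : δ < δ₀ := lt_of_lt_of_le hδlt ((min_le_left _ _).trans (min_le_left _ _))
  have hδ1 : δ < 1 := lt_of_lt_of_le hδlt ((min_le_left _ _).trans (min_le_right _ _))
  have hδr : 4 * δ ≤ r := by
    have := lt_of_lt_of_le hδlt ((min_le_right _ _).trans (min_le_left _ _)); linarith
  have hδd : 2 * δ < d₀ := by
    have := lt_of_lt_of_le hδlt ((min_le_right _ _).trans (min_le_right _ _)); linarith
  set W : Finset (Site 2) := rowTail R δ s \ rowTail R δ s' with hW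
  -- structure of `W`
  have hWv : ∀ v ∈ W, Orient.nrm o v = ⌈h / δ⌉ ∧ ∃ u ∈ Ico s s',
      R.boundary u = (((δ * (Orient.tng o v : ℝ) : ℝ)) : ℂ) * Orient.e o + ((h : ℝ) : ℂ) * Orient.ν o ∧
      dist (meshPoint δ v) (R.boundary u) < δ :=
    fun v hv => kwl_sdiff_vertex R h1 hσs hss'.le hs'σ' h3 hcl hop hsep hδ hδr hδd hv
  -- the index set
  set K : Finset ℤ := W.image (Orient.tng o) with hK
  have hinjK : Set.InjOn (Orient.tng o) ↑W := fun v hv v' hv' heq =>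
    kwl_eq_of_tng_eq_of_nrm_eq heq (by rw [(hWv v hv).1, (hWv v' hv').1])
  have hK1 : ∀ k ∈ K, α ≤ δ * k ∧ δ * k ≤ β := by
    intro k hk
    obtain ⟨v, hv, rfl⟩ := Finset.mem_image.1 hk
    obtain ⟨-, u, hu, hux, -⟩ := hWv v hv
    have hTu : T u = δ * (Orient.tng o v : ℝ) := by
      show Orient.tngC o (R.boundary u) = _
      rw [hux, Orient.tngC_combo]
    rw [← hTu]
    exact hchord u ⟨hu.1, hu.2.le⟩
  have hK2 : ∀ k : ℤ, α < δ * k → δ * k < β → k ∈ K := by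
    intro k hk1 hk2
    have hmem : (δ * k : ℝ) ∈ uIcc (T s) (T s') := ⟨hk1.le, hk2.le⟩
    obtain ⟨u, hu, hTu, hbu⟩ := kwl_exists_param_of_mem_uIcc R hss'.le
      (fun t ht => hh t ⟨hσs.le.trans ht.1, ht.2.trans hs'σ'.le⟩) hmem
    have hus' : u ≠ s' := by
      intro heq
      have hTs' : T s' = δ * k := by rw [← heq]; exact hTu
      rcases le_total (T s) (T s') with hle | hle
      · rw [hβ, sup_eq_right.2 hle] at hk2; linarith
      · rw [hα, inf_eq_right.2 hle] at hk1; linarith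
    set v : Site 2 := (Orient.frame o).symm ![k, ⌈h / δ⌉] with hv
    have hfv : Orient.frame o v = ![k, ⌈h / δ⌉] := by rw [hv, Equiv.apply_symm_apply]
    have htv : Orient.tng o v = k := by rw [← Orient.frame_apply_zero, hfv]; rfl
    have hnv : Orient.nrm o v = ⌈h / δ⌉ := by rw [← Orient.frame_apply_one, hfv]; rfl
    have hvW : v ∈ W := kwl_mem_sdiff_of_foot R h1 hσs.le hs'σ'.le h3 hcl hop hδ (by linarith) hnv
      (u := u) ⟨hu.1, lt_of_le_of_ne hu.2 hus'⟩ (by rw [hbu, htv])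
    exact Finset.mem_image.2 ⟨v, hvW, htv⟩
  have hRδ := hRiem δ hδ hδδ₀ K hK1 hK2
  -- the point asymptotics on `W`
  have hpt : ∀ v ∈ W, |F δ v / (δ * N δ) - f (δ * (Orient.tng o v : ℝ))| ≤ ε₁ := by
    intro v hv
    obtain ⟨-, u, hu, hux, hdist⟩ := hWv v hv
    have hvrow : v ∈ boundaryRow R δ := rowTail_subset R δ s (Finset.mem_sdiff.1 hv).1
    have := hNδ v hvrow u ⟨hσs.le.trans hu.1, hu.2.le.trans hs'σ'.le⟩ (by linarith)
    rwa [hux] at this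
  -- the sums
  have hsumK : ∑ k ∈ K, δ * f (δ * k) = ∑ v ∈ W, δ * f (δ * (Orient.tng o v : ℝ)) := by
    rw [hK, Finset.sum_image hinjK]
  have hcardK : K.card = W.card := Finset.card_image_of_injOn hinjK
  have hcardW : (W.card : ℝ) * δ ≤ β - α + δ := by
    rw [← hcardK]; exact kwl_card_mul_le hδ hαβ.le hK1
  have hS : (∑ v ∈ W, F δ v) / N δ = ∑ v ∈ W, δ * (F δ v / (δ * N δ)) := by
    rw [Finset.sum_div]
    refine Finset.sum_congr rfl fun v _ => ?_
    rw [mul_div_assoc', mul_div_mul_left _ _ hδ.ne']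
  have hdiff : |(∑ v ∈ W, F δ v) / N δ - ∑ v ∈ W, δ * f (δ * (Orient.tng o v : ℝ))| ≤
      (W.card : ℝ) * δ * ε₁ := by
    rw [hS, ← Finset.sum_sub_distrib]
    refine (Finset.abs_sum_le_sum_abs _ _).trans ?_
    have : ∀ v ∈ W, |δ * (F δ v / (δ * N δ)) - δ * f (δ * (Orient.tng o v : ℝ))| ≤ δ * ε₁ := by
      intro v hv
      rw [← mul_sub, abs_mul, abs_of_pos hδ]
      exact mul_le_mul_of_nonneg_left (hpt v hv) hδ.le
    refine (Finset.sum_le_sum this).trans ?_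
    rw [Finset.sum_const, nsmul_eq_mul]
    linarith
  -- assemble
  rw [Real.dist_eq]
  have hε4 : (W.card : ℝ) * δ * ε₁ ≤ ε / 4 := by
    have hle1 : (W.card : ℝ) * δ ≤ β - α + 1 := by linarith
    calc (W.card : ℝ) * δ * ε₁ ≤ (β - α + 1) * ε₁ := by gcongr
      _ = (ε / 4) * ((β - α + 1) / (β - α + 2)) := by rw [hε₁]; field_simp
      _ ≤ (ε / 4) * 1 := by
          gcongr
          rw [div_le_one hL]; linarith
      _ = ε / 4 := mul_one _
  calc |(∑ v ∈ W, F δ v) / N δ - ∫ x in α..β, f x|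
      ≤ |(∑ v ∈ W, F δ v) / N δ - ∑ v ∈ W, δ * f (δ * (Orient.tng o v : ℝ))| +
          |∑ k ∈ K, δ * f (δ * k) - ∫ x in α..β, f x| := by
        rw [hsumK]; exact abs_sub_le _ _ _
    _ ≤ ε / 4 + ε / 2 := add_le_add (hdiff.trans hε4) hRδ
    _ < ε := by linarith

end Summit.CriticalPhenomena.CardyFormulaZ2.Cruxes.RectilinearCardy.ExcursionKernelCovariance

end
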